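import Mathlib.Analysis.Calculus.Deriv.Inv
import Mathlib.Analysis.Calculus.Deriv.Pow
import Mathlib.Analysis.Calculus.Deriv.MeanValue
import Mathlib.Analysis.Calculus.ContDiff.Deriv
import Mathlib.Algebra.Module.ZLattice.Summable
import Literature.MathematicalPhysics.StatisticalMechanics.Theil2006
import HarnessLib

/-!
# Theil 2006: consequences of the decay hypothesis (5) — Lemma 2.1 (12) and finite lattice sums

Topic: `Literature/MathematicalPhysics/StatisticalMechanics`; companion to `Theil2006.lean`
(F. Theil, *A proof of crystallization in two dimensions*, Comm. Math. Phys. **262** (2006)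
209–236), whose named facts (Theorems 1.1, 1.2, Corollary 1.3, Lemma 2.2, Proposition 2.3) take
the hypotheses `Theil2006.IsAdmissible α V` ((1)–(5) of Theorem 1.1). Everything here is PROVED;
no named fact is added or discharged.

## Content

* `Theil2006.IsAdmissible.alpha_nonneg`: (5) forces `α ≥ 0`.
* `Theil2006.IsAdmissible.abs_deriv_le`: `|V'(r)| ≤ α r⁻⁶/6` for `r ≥ 4/3`, and
  `Theil2006.IsAdmissible.tendsto_deriv`: `V' → 0`.
* `Theil2006.IsAdmissible.abs_apply_le`: `|V(r)| ≤ α r⁻⁵/30` for `r ≥ 4/3`, whence the printed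
  **Lemma 2.1 (12)** `|V(r)| ≤ α r⁻⁵` (`abs_apply_le'`). In the paper (12) is read off from (5) and
  `V → 0` by integrating twice from `∞`; here the two integrations are replaced by the mean value
  inequality (`Convex.mul_sub_le_image_sub_of_le_deriv`) applied to `V' ∓ (α/6) r⁻⁶` and
  `V ± (α/30) r⁻⁵`, so no improper integral is needed: if `V'(r) > (α/6) r⁻⁶` at one point then
  `V' - (α/6) x⁻⁶` is non-decreasing from there on, `V'` stays bounded below by a positive constant
  and `V → +∞`, contradicting `V → 0`.
* `Theil2006.summable_norm_triPoint_sub_rpow`: the lattice `p`-series `∑_{ξ ∈ A₂} |ξ - p|^s < ∞`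
  for `s < -2` (Mathlib's `ZLattice.summable_norm_sub_rpow` for the `ℤ`-span of `b₁, b₂`, pulled
  back along the injective labelling `triPoint`), with the local finiteness statements
  `tendsto_norm_triPoint_cofinite`, `tendsto_norm_sub_triPoint_cofinite`.
* `Theil2006.IsAdmissible.summable_norm_sub`, `Theil2006.IsAdmissible.summable_dirichlet`: for an
  admissible `V`, `ξ ↦ V(|p - ξ|)` is absolutely summable over `A₂`, so the one-particle `tsum`s in
  `Theil2006.dirichletEnergy` (Corollary 1.3, `Theil2006_dirichletGroundStates`) are genuine sums
  for every clamped configuration — the "no junk value" claim of the module docstring of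
  `Theil2006.lean`, now checked.

These are the elementary first steps (Theil 2006, §2.2, Lemma 2.1) shared by any proof of the
named facts of `Theil2006.lean`; the facts themselves (in particular Corollary 1.3, which needs the
whole local energy estimate of §§2–4 of the paper) remain undischarged.
-/

noncomputable section

open scoped BigOperators Topology
open Filter Set

namespace Literature.MathematicalPhysics.StatisticalMechanics

namespace Theil2006

section Decay

variable {α : ℝ} {V : ℝ → ℝ}

/-- Mean-value bookkeeping behind Lemma 2.1: if `W' = w`, `w' = w₁` on `[a, ∞)` (`a > 0`),
`w₁(x) ≥ -α x⁻⁷` for `x > a`, `α ≥ 0` and `W → 0` at `∞`, then `w(r) ≤ (α/6) r⁻⁶` for `r ≥ a`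
(otherwise `w - (α/6) x⁻⁶` is non-decreasing, `w ≥ δ > 0` on `[r, ∞)` and `W → +∞`). [folklore] -/
private theorem deriv_le_aux {W w w₁ : ℝ → ℝ} {a : ℝ} (ha : 0 < a) (hα : 0 ≤ α)
    (hW : ∀ x, a ≤ x → HasDerivAt W (w x) x) (hw : ∀ x, a ≤ x → HasDerivAt w (w₁ x) x)
    (hw₁ : ∀ x, a < x → -(α * x⁻¹ ^ 7) ≤ w₁ x) (hW0 : Tendsto W atTop (𝓝 0)) {r : ℝ}
    (hr : a ≤ r) : w r ≤ α / 6 * r⁻¹ ^ 6 := by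
  by_contra hlt
  have hδ : 0 < w r - α / 6 * r⁻¹ ^ 6 := sub_pos.2 (not_le.1 hlt)
  -- `φ(s) = w(s) - (α/6) s⁻⁶` has derivative `w₁(s) + α s⁻⁷ ≥ 0`
  have hφd : ∀ s, a ≤ s →
      HasDerivAt (fun s => w s - α / 6 * s⁻¹ ^ 6) (w₁ s + α * s⁻¹ ^ 7) s := by
    intro s hs
    have hs0 : s ≠ 0 := (ha.trans_le hs).ne'
    have h1 := ((hasDerivAt_inv hs0).fun_pow 6).const_mul (α / 6)
    refine ((hw s hs).fun_sub h1).congr_deriv ?_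
    norm_num only
    ring
  have hmono : ∀ s, r ≤ s → w r - α / 6 * r⁻¹ ^ 6 ≤ w s - α / 6 * s⁻¹ ^ 6 := by
    intro s hs
    have h := (convex_Ici r).mul_sub_le_image_sub_of_le_deriv
      (f := fun s => w s - α / 6 * s⁻¹ ^ 6) ?_ ?_ (C := 0) ?_ r self_mem_Ici s hs hs
    · linarith
    · exact fun x hx => (hφd x (hr.trans hx)).continuousAt.continuousWithinAt
    · rw [interior_Ici]
      exact fun x hx => (hφd x (hr.trans (le_of_lt hx))).differentiableAt.differentiableWithinAt
    · rw [interior_Ici]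
      intro x hx
      rw [(hφd x (hr.trans (le_of_lt hx))).deriv]
      linarith [hw₁ x (hr.trans_lt hx)]
  -- hence `w ≥ δ := w r - (α/6) r⁻⁶ > 0` on `[r, ∞)`
  have hws : ∀ s, r ≤ s → w r - α / 6 * r⁻¹ ^ 6 ≤ w s := by
    intro s hs
    have h1 := hmono s hs
    have hs0 : 0 < s := ha.trans_le (hr.trans hs)
    have h2 : 0 ≤ α / 6 * s⁻¹ ^ 6 := by positivity
    linarith
  -- so `W` grows at least linearly on `[r, ∞)`
  have hWs : ∀ s, r ≤ s → (w r - α / 6 * r⁻¹ ^ 6) * (s - r) ≤ W s - W r := by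
    intro s hs
    refine (convex_Ici r).mul_sub_le_image_sub_of_le_deriv ?_ ?_ ?_ r self_mem_Ici s hs hs
    · exact fun x hx => (hW x (hr.trans hx)).continuousAt.continuousWithinAt
    · rw [interior_Ici]
      exact fun x hx => (hW x (hr.trans (le_of_lt hx))).differentiableAt.differentiableWithinAt
    · rw [interior_Ici]
      intro x hx
      rw [(hW x (hr.trans (le_of_lt hx))).deriv]
      exact hws x (le_of_lt hx)
  -- contradiction with `W → 0`
  set δ := w r - α / 6 * r⁻¹ ^ 6 with hδ_def
  obtain ⟨s, hs1, hs2⟩ := ((hW0.eventually_lt_const zero_lt_one).and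
    (eventually_ge_atTop (max r (r + (1 - W r) / δ + 1)))).exists
  have hrs : r ≤ s := (le_max_left _ _).trans hs2
  have hs3 : r + (1 - W r) / δ + 1 ≤ s := (le_max_right _ _).trans hs2
  have h4 := hWs s hrs
  have h5 : δ * ((1 - W r) / δ + 1) ≤ δ * (s - r) :=
    mul_le_mul_of_nonneg_left (by linarith) hδ.le
  have h6 : δ * ((1 - W r) / δ + 1) = 1 - W r + δ := by
    field_simp
  linarith

/-- Second step of the bookkeeping: if `W' = w` on `[a, ∞)` (`a > 0`), `w(x) ≤ (α/6) x⁻⁶` there,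
`α ≥ 0` and `W → 0`, then `W(r) ≥ -(α/30) r⁻⁵` for `r ≥ a` (`W + (α/30) x⁻⁵` is non-increasing
and tends to `0`). [folklore] -/
private theorem le_aux {W w : ℝ → ℝ} {a : ℝ} (ha : 0 < a)
    (hW : ∀ x, a ≤ x → HasDerivAt W (w x) x) (hw : ∀ x, a ≤ x → w x ≤ α / 6 * x⁻¹ ^ 6)
    (hW0 : Tendsto W atTop (𝓝 0)) {r : ℝ} (hr : a ≤ r) : -(α / 30 * r⁻¹ ^ 5) ≤ W r := by
  have hΦd : ∀ s, a ≤ s →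
      HasDerivAt (fun s => W s + α / 30 * s⁻¹ ^ 5) (w s - α / 6 * s⁻¹ ^ 6) s := by
    intro s hs
    have hs0 : s ≠ 0 := (ha.trans_le hs).ne'
    have h1 := ((hasDerivAt_inv hs0).fun_pow 5).const_mul (α / 30)
    refine ((hW s hs).fun_add h1).congr_deriv ?_
    norm_num only
    ring
  have hanti : ∀ s, r ≤ s → W s + α / 30 * s⁻¹ ^ 5 ≤ W r + α / 30 * r⁻¹ ^ 5 := by
    intro s hs
    have h := (convex_Ici r).image_sub_le_mul_sub_of_deriv_le
      (f := fun s => W s + α / 30 * s⁻¹ ^ 5) ?_ ?_ (C := 0) ?_ r self_mem_Ici s hs hs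
    · linarith
    · exact fun x hx => (hΦd x (hr.trans hx)).continuousAt.continuousWithinAt
    · rw [interior_Ici]
      exact fun x hx => (hΦd x (hr.trans (le_of_lt hx))).differentiableAt.differentiableWithinAt
    · rw [interior_Ici]
      intro x hx
      rw [(hΦd x (hr.trans (le_of_lt hx))).deriv]
      linarith [hw x (hr.trans (le_of_lt hx))]
  have hΦ0 : Tendsto (fun s : ℝ => W s + α / 30 * s⁻¹ ^ 5) atTop (𝓝 0) := by
    have h1 : Tendsto (fun s : ℝ => α / 30 * s⁻¹ ^ 5) atTop (𝓝 (α / 30 * 0 ^ 5)) :=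
      (tendsto_inv_atTop_zero.pow 5).const_mul (α / 30)
    simpa using hW0.add h1
  have h0 : (0 : ℝ) ≤ W r + α / 30 * r⁻¹ ^ 5 :=
    le_of_tendsto hΦ0 ((eventually_ge_atTop r).mono fun s hs => hanti s hs)
  linarith

/-- Hypothesis (5) `|V''(r)| ≤ α r⁻⁷` can only hold with `α ≥ 0`. [folklore] -/
theorem IsAdmissible.alpha_nonneg (hV : IsAdmissible α V) : 0 ≤ α := by
  have h1 := (abs_nonneg _).trans (hV.decay 2 (by norm_num))
  have h2 : (0 : ℝ) < 2⁻¹ ^ 7 := by positivity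
  nlinarith [h1, h2]

/-- `V` is differentiable on `(1-α, ∞)` with derivative `V'`. [folklore] -/
theorem IsAdmissible.hasDerivAt (hV : IsAdmissible α V) {x : ℝ} (hx : 1 - α < x) :
    HasDerivAt V (deriv V x) x :=
  ((hV.contDiffOn.differentiableOn (by norm_num)).differentiableAt (Ioi_mem_nhds hx)).hasDerivAt

/-- `V'` is differentiable on `(1-α, ∞)` with derivative `V''`. [folklore] -/
theorem IsAdmissible.hasDerivAt_deriv (hV : IsAdmissible α V) {x : ℝ} (hx : 1 - α < x) :
    HasDerivAt (deriv V) (deriv^[2] V x) x := by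
  show HasDerivAt (deriv V) (deriv (deriv V) x) x
  exact (((hV.contDiffOn.deriv_of_isOpen isOpen_Ioi (m := 1) (one_add_one_eq_two).le)
    |>.differentiableOn one_ne_zero).differentiableAt (Ioi_mem_nhds hx)).hasDerivAt

/-- `|V'(r)| ≤ α r⁻⁶ / 6` for `r ≥ 4/3`: one integration of (5) from `∞` (where `V' → 0` because
`V → 0`); the intermediate step towards Lemma 2.1 (12). [folklore] -/
theorem IsAdmissible.abs_deriv_le (hV : IsAdmissible α V) {r : ℝ} (hr : 4 / 3 ≤ r) :
    |deriv V r| ≤ α / 6 * r⁻¹ ^ 6 := by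
  have hα := hV.alpha_nonneg
  have h43 : (0 : ℝ) < 4 / 3 := by norm_num
  have hd1 : ∀ x : ℝ, 4 / 3 ≤ x → HasDerivAt V (deriv V x) x :=
    fun x hx => hV.hasDerivAt (by linarith)
  have hd2 : ∀ x : ℝ, 4 / 3 ≤ x → HasDerivAt (deriv V) (deriv^[2] V x) x :=
    fun x hx => hV.hasDerivAt_deriv (by linarith)
  rw [_root_.abs_le]
  constructor
  · have h : -deriv V r ≤ α / 6 * r⁻¹ ^ 6 :=
      deriv_le_aux (W := fun x => -V x) (w := fun x => -deriv V x)
        (w₁ := fun x => -deriv^[2] V x) h43 hα (fun x hx => (hd1 x hx).neg)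
        (fun x hx => (hd2 x hx).neg)
        (fun x hx => neg_le_neg (_root_.abs_le.1 (hV.decay x hx)).2)
        (by simpa using hV.tendsto_zero.neg) hr
    linarith
  · exact deriv_le_aux h43 hα hd1 hd2 (fun x hx => (_root_.abs_le.1 (hV.decay x hx)).1)
      hV.tendsto_zero hr

/-- **Theil 2006, Lemma 2.1 (12)** (`|V(r)| ≤ α r⁻⁵` for `r ≥ 4/3`, as recorded in the module
docstring of `Theil2006.lean` from the accepted preprint), with the sharper constant that two
integrations of (5) from `∞` actually give: `|V(r)| ≤ α r⁻⁵ / 30` for `r ≥ 4/3`.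
[cite: Theil2006, Lemma 2.1 (12)] -/
theorem IsAdmissible.abs_apply_le (hV : IsAdmissible α V) {r : ℝ} (hr : 4 / 3 ≤ r) :
    |V r| ≤ α / 30 * r⁻¹ ^ 5 := by
  have hα := hV.alpha_nonneg
  have h43 : (0 : ℝ) < 4 / 3 := by norm_num
  have hd1 : ∀ x : ℝ, 4 / 3 ≤ x → HasDerivAt V (deriv V x) x :=
    fun x hx => hV.hasDerivAt (by linarith)
  rw [_root_.abs_le]
  constructor
  · exact le_aux h43 hd1 (fun x hx => (_root_.abs_le.1 (hV.abs_deriv_le hx)).2)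
      hV.tendsto_zero hr
  · have h : -(α / 30 * r⁻¹ ^ 5) ≤ -V r :=
      le_aux (W := fun x => -V x) (w := fun x => -deriv V x) h43
        (fun x hx => (hd1 x hx).neg)
        (fun x hx => by linarith [(_root_.abs_le.1 (hV.abs_deriv_le hx)).1])
        (by simpa using hV.tendsto_zero.neg) hr
    linarith

/-- **Theil 2006, Lemma 2.1 (12)** as printed: `|V(r)| ≤ α r⁻⁵` for `r ≥ 4/3`.
[cite: Theil2006, Lemma 2.1 (12)] -/
theorem IsAdmissible.abs_apply_le' (hV : IsAdmissible α V) {r : ℝ} (hr : 4 / 3 ≤ r) :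
    |V r| ≤ α * r⁻¹ ^ 5 := by
  have h1 := hV.abs_apply_le hr
  have h2 : 0 ≤ α * r⁻¹ ^ 5 := by
    have := hV.alpha_nonneg
    have : (0 : ℝ) < r := by linarith
    positivity
  linarith

/-- `V'(r) → 0` as `r → ∞`. [folklore] -/
theorem IsAdmissible.tendsto_deriv (hV : IsAdmissible α V) : Tendsto (deriv V) atTop (𝓝 0) := by
  have h1 : Tendsto (fun r : ℝ => α / 6 * r⁻¹ ^ 6) atTop (𝓝 0) := by
    simpa using (tendsto_inv_atTop_zero.pow 6).const_mul (α / 6)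
  refine squeeze_zero_norm' ?_ h1
  filter_upwards [eventually_ge_atTop (4 / 3 : ℝ)] with r hr
  simpa only [Real.norm_eq_abs] using hV.abs_deriv_le hr

end Decay

/-! ### Lattice sums over `A₂` -/

/-- `triPoint (m, n) = m b₁ + n b₂`. [folklore] -/
theorem triPoint_apply (k : ℤ × ℤ) : triPoint k = (k.1 : ℝ) • triVec₁ + (k.2 : ℝ) • triVec₂ :=
  rfl

/-- `m² + m n + n² ≥ ¾ max(m², n²)`: the norm form of `A₂` dominates the sup norm of the label,
`¾ ‖(m, n)‖² ≤ ‖m b₁ + n b₂‖²`. [folklore] -/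
theorem norm_label_sq_le (k : ℤ × ℤ) : 3 / 4 * ‖k‖ ^ 2 ≤ ‖triPoint k‖ ^ 2 := by
  rw [norm_triPoint_sq, Prod.norm_def, Int.norm_eq_abs, Int.norm_eq_abs]
  obtain ⟨m, n⟩ := k
  push_cast
  rcases le_total |(m : ℝ)| |(n : ℝ)| with h | h
  · rw [max_eq_right h, sq_abs]
    nlinarith [sq_nonneg (2 * (m : ℝ) + n)]
  · rw [max_eq_left h, sq_abs]
    nlinarith [sq_nonneg ((m : ℝ) + 2 * n)]

/-- `A₂` is locally finite: `|ξ| → ∞` along the cofinite filter of labels. [folklore] -/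
theorem tendsto_norm_triPoint_cofinite :
    Tendsto (fun k : ℤ × ℤ => ‖triPoint k‖) cofinite atTop := by
  have h1 : Tendsto (fun k : ℤ × ℤ => ‖k‖) cofinite atTop := by
    rw [← cocompact_eq_cofinite (ℤ × ℤ)]
    exact tendsto_norm_cocompact_atTop
  refine tendsto_atTop_mono (fun k => ?_) (h1.const_mul_atTop (by norm_num : (0 : ℝ) < 1 / 2))
  have h2 := norm_label_sq_le k
  have hk := norm_nonneg k
  have ht := norm_nonneg (triPoint k)
  nlinarith [mul_nonneg ht hk]

/-- For every `p ∈ ℝ²`, `|p - ξ| → ∞` as `ξ` runs through `A₂` (cofinite filter). [folklore] -/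
theorem tendsto_norm_sub_triPoint_cofinite (p : Plane) :
    Tendsto (fun k : ℤ × ℤ => ‖p - triPoint k‖) cofinite atTop := by
  refine tendsto_atTop_mono (fun k => ?_)
    (tendsto_atTop_add_const_right _ (-‖p‖) tendsto_norm_triPoint_cofinite)
  have h := norm_sub_norm_le (triPoint k) p
  rw [norm_sub_rev] at h
  linarith

/-- `b₁ = (1, 0)` and `b₂ = (1/2, √3/2)` are linearly independent. [folklore] -/
theorem linearIndependent_triVec : LinearIndependent ℝ ![triVec₁, triVec₂] := by
  refine LinearIndependent.pair_iff.2 fun s t hst => ?_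
  have e0 : (s • triVec₁ + t • triVec₂) 0 = s + t / 2 := by
    simp [triVec₁, triVec₂]; ring
  have e1 : (s • triVec₁ + t • triVec₂) 1 = √3 / 2 * t := by
    simp [triVec₁, triVec₂]; ring
  rw [hst] at e0 e1
  have h3 : (0 : ℝ) < √3 := Real.sqrt_pos.2 (by norm_num)
  have e0' : s + t / 2 = 0 := by simpa using e0.symm
  have e1' : √3 / 2 * t = 0 := by simpa using e1.symm
  have ht : t = 0 := by
    rcases mul_eq_zero.1 e1' with h | h
    · exact absurd h (by positivity)
    · exact h
  exact ⟨by linarith [ht], ht⟩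

/-- The lattice `p`-series of `A₂`: `∑_{ξ ∈ A₂} |ξ - p|^s < ∞` for `s < -2` and every `p ∈ ℝ²`
(Mathlib's `ZLattice.summable_norm_sub_rpow` for the `ℤ`-span of `b₁, b₂`). [folklore] -/
theorem summable_norm_triPoint_sub_rpow (p : Plane) {s : ℝ} (hs : s < -2) :
    Summable fun k : ℤ × ℤ => ‖triPoint k - p‖ ^ s := by
  obtain ⟨b, hb⟩ : ∃ b : Module.Basis (Fin 2) ℝ Plane, ⇑b = ![triVec₁, triVec₂] :=
    ⟨basisOfLinearIndependentOfCardEqFinrank linearIndependent_triVec (by simp),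
      coe_basisOfLinearIndependentOfCardEqFinrank _ _⟩
  have hmem : ∀ k : ℤ × ℤ, triPoint k ∈ Submodule.span ℤ (Set.range b) := fun k => by
    have h0 : triVec₁ ∈ Submodule.span ℤ (Set.range b) := Submodule.subset_span ⟨0, by simp [hb]⟩
    have h1 : triVec₂ ∈ Submodule.span ℤ (Set.range b) := Submodule.subset_span ⟨1, by simp [hb]⟩
    rw [triPoint_apply, Int.cast_smul_eq_zsmul ℝ, Int.cast_smul_eq_zsmul ℝ]
    exact Submodule.add_mem _ (Submodule.smul_mem _ _ h0) (Submodule.smul_mem _ _ h1)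
  have hrank : Module.finrank ℤ (Submodule.span ℤ (Set.range b)) = 2 := by
    rw [ZLattice.rank ℝ (Submodule.span ℤ (Set.range b)), finrank_euclideanSpace_fin]
  have hsum := ZLattice.summable_norm_sub_rpow (Submodule.span ℤ (Set.range b)) s
    (by rw [hrank]; exact_mod_cast hs) p
  have hinj : Function.Injective fun k : ℤ × ℤ =>
      (⟨triPoint k, hmem k⟩ : Submodule.span ℤ (Set.range b)) :=
    fun _ _ h => triPoint_injective (congrArg Subtype.val h)
  simpa only [Function.comp_def] using hsum.comp_injective hinj

/-- For an admissible potential and any `p ∈ ℝ²`, `ξ ↦ V(|p - ξ|)` is absolutely summable over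
`A₂` (tail `|V| ≤ α r⁻⁵/30` against the lattice `p`-series). [folklore] -/
theorem IsAdmissible.summable_norm_sub {α : ℝ} {V : ℝ → ℝ} (hV : IsAdmissible α V) (p : Plane) :
    Summable fun k : ℤ × ℤ => V ‖p - triPoint k‖ := by
  refine Summable.of_norm_bounded_eventually
    ((summable_norm_triPoint_sub_rpow p (by norm_num : (-5 : ℝ) < -2)).mul_left (α / 30)) ?_
  filter_upwards [(tendsto_norm_sub_triPoint_cofinite p).eventually_ge_atTop (4 / 3)] with k hk
  rw [Real.norm_eq_abs]
  refine (hV.abs_apply_le hk).trans (le_of_eq ?_)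
  have h0 : (0 : ℝ) ≤ ‖triPoint k - p‖ := norm_nonneg _
  rw [Real.rpow_neg h0, norm_sub_rev (triPoint k) p, inv_pow]
  norm_cast

/-- The one-particle sums `∑_{x' ∈ A₂ ∖ 𝒜} V(|y(x) - y(x')|)` in `E_𝒜` (Corollary 1.3) converge
absolutely for every clamped configuration `y ∈ Y_𝒜^Dir` and admissible `V`: the `tsum`s in
`dirichletEnergy` are genuine sums. [cite: Theil2006, §1 Corollary 1.3] -/
theorem IsAdmissible.summable_dirichlet {α : ℝ} {V : ℝ → ℝ} (hV : IsAdmissible α V)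
    {A : Finset (ℤ × ℤ)} {y : ℤ × ℤ → Plane} (hy : IsClampedOutside A y) (k : ℤ × ℤ) :
    Summable fun k' : {k' : ℤ × ℤ // k' ∉ A} => V (dist (y k) (y k'.1)) := by
  have h := (hV.summable_norm_sub (y k)).subtype {k' | k' ∉ A}
  refine h.congr fun k' => ?_
  simp only [Function.comp_apply]
  rw [dist_eq_norm, hy k'.1 k'.2]

end Theil2006

end Literature.MathematicalPhysics.StatisticalMechanics

end
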